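import Summits.ResolutionOfSingularities.ResolutionOfSingularities.Theorems.FrobeniusLadderFInjectiveMacaulayficationFullLastCentreAxisOrder
import Summits.ResolutionOfSingularities.ResolutionOfSingularities.Theorems.FrobeniusLadderFInjectiveMacaulayficationFullLastCentreResidual
import HarnessLib

/-!
# K10e — THE POINT-CHAIN CAP IN THE TYPED LAYER: along ANY chain of POINT blow-ups from an exceptional-free stage, a drop point satisfying the
# drop-point budget has residual order `ρ ≤ 8` (K7 transported from abstract letters to honest polynomials)
# (crux `FInjectiveMacaulayfication` stmt-ResolutionOfSingularities-15315, chain w45a; the typed chain-level conjecture `MC8cChain` of `Lines/T_canon_door.lean` v6.2 is a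
# THEOREM for the rule «always blow up the point»; seat res-L1-w45a-lead-1 g16)

[OURS · L1 W4.5a] Support file (`--supports stmt-ResolutionOfSingularities-15315 --as helper`); replaces the role of NO printed item; NOT a statement of any manuscript;
proves nothing of the crux; OURS counted 0. AI-written (AI review is weaker than expert review).

CONTENT. ★ `alpha_transport` — the EXPONENT IDENTITY of the one-step law, exported: along a chart of the blow-up of any permissible coordinate centre with `L ∈ Nor`,
`6·ε_L + α′ = tau α + ν·ε_L` (`ν` the minimal normal degree of `N`). For a POINT centre (`Nor = univ`): `α′_n = α_n` (`n ≠ L`) and `α′_L + 6 = |α| + ν`, `ν = ord₀ N = ρ`.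
★ `PointTame` — the invariant «`ord₀ N ≤ 8` OR every exceptional letter has non-positive slack (`2·d_n ≤ α_n`)»; ★ `pointTame_step` — preserved by point blow-ups
(the new letter's slack is `8 − ρ + Σ slack ≤ −1` while `ρ ≥ 9`; once `ρ ≤ 8` the point law `rho_le_rho_of_point` keeps it); ★ `ordLE_eight_of_pointTame_drop` — at a
drop point the budget `ord₀ Disc′ ≤ 8 + 2Σ_{E∋x′} d′` turns non-positive slacks into `ρ′ ≤ 16 − ρ ≤ 7`; ★★★ `pointChain_cap` — assembly along `PointReachable`
(chains of point blow-ups): from `S₀.Exc = ∅`, every drop point with the drop-point budget has `ρ ≤ 8`. Exponent bookkeeping only; no named fact; any field.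
-/

-- single-problem summit: the doubled namespace component is forced
set_option linter.dupNamespace false

noncomputable section

open MvPolynomial Finsupp
open Summit.ResolutionOfSingularities.ResolutionOfSingularities.Theorems.FInjectiveMacaulayfication.LastCentreDefs
open Summit.ResolutionOfSingularities.ResolutionOfSingularities.Theorems.FInjectiveMacaulayfication.LastCentreAxisOrder
open Summit.ResolutionOfSingularities.ResolutionOfSingularities.Theorems.FInjectiveMacaulayfication.LastCentreResidual

namespace Summit.ResolutionOfSingularities.ResolutionOfSingularities.Theorems.FInjectiveMacaulayfication.LastCentrePointChain

variable {k : Type} [Field k]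

/-- ★ THE EXPONENT IDENTITY (exported form of the core of K10 `residual_transport`): `6ε_L + α′ = tau α + ν ε_L`. [OURS · L1 W4.5a] -/
theorem alpha_transport {S S' : Stage k} {Nor : Finset Letter} {L : Letter} {α α' : Expo} {N N' : YPoly k} (hL : L ∈ Nor)
    (hch : IsChart S Nor L S') (hN : IsResidual S.Exc S.D α N) (hN' : IsResidual S'.Exc S'.D α' N')
    {ν : ℕ} (hν₁ : ∃ e ∈ N.support, norDeg Nor e = ν) (hν₂ : ∀ e ∈ N.support, ν ≤ norDeg Nor e) :
    Finsupp.single L 6 + α' = tau Nor L α + Finsupp.single L ν := by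
  classical
  obtain ⟨hD, hαoff, hNres⟩ := hN
  obtain ⟨hD', hα'off, hN'res⟩ := hN'
  set A : Expo := tau Nor L α with hA
  set B : Expo := Finsupp.single L 6 + α' with hB
  have hEQ : monomial A (1 : k) * chartMap Nor L N = monomial B (1 : k) * N' := by
    have h1 : chartMap Nor L S.D = monomial A 1 * chartMap Nor L N := by rw [hD, map_mul, chartMap_monomial]
    have h2 : X L ^ 6 * S'.D = monomial B 1 * N' := by rw [hD', ← mul_assoc, X_pow_eq_monomial, monomial_mul, one_mul]
    rw [← h1, ← h2, disc_chart hch]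
  have hExc' : S'.Exc = insert L S.Exc := hch.2.2.2.1
  have fromN' : ∀ e₀ ∈ N'.support, A ≤ B + e₀ ∧ ∃ e₁ ∈ N.support, B + e₀ - A = tau Nor L e₁ := by
    intro e₀ he₀
    have hc : coeff (B + e₀) (monomial A (1 : k) * chartMap Nor L N) ≠ 0 := by
      rw [hEQ, coeff_add_monomial_mul]; exact MvPolynomial.mem_support_iff.mp he₀
    obtain ⟨hAle, hc2⟩ := le_and_coeff_of_coeff_monomial_mul hc
    obtain ⟨e₁, he₁, he₁eq⟩ := exists_of_mem_support_chartMap Nor L N _ (MvPolynomial.mem_support_iff.mpr hc2)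
    exact ⟨hAle, e₁, he₁, he₁eq⟩
  have fromN : ∀ e ∈ N.support, B ≤ A + tau Nor L e := by
    intro e he
    have hc : coeff (A + tau Nor L e) (monomial B (1 : k) * N') ≠ 0 := by
      rw [← hEQ, coeff_add_monomial_mul, coeff_tau_chartMap]; exact MvPolynomial.mem_support_iff.mp he
    exact (le_and_coeff_of_coeff_monomial_mul hc).1
  ext n
  simp only [Finsupp.coe_add, Pi.add_apply, Finsupp.single_apply]
  apply le_antisymm
  · -- B n ≤ A n + [L = n] ν
    by_cases hnL : L = n
    · subst hnL
      rw [if_pos rfl]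
      obtain ⟨e₀, he₀, he₀ν⟩ := hν₁
      have hle := fromN e₀ he₀ L
      simp only [Finsupp.coe_add, Pi.add_apply, tau_apply_self Nor L e₀ hL, hB, Finsupp.single_eq_same] at hle ⊢
      omega
    · rw [if_neg hnL, add_zero]
      by_cases hn : n ∈ S.Exc
      · obtain ⟨e₁, he₁, he₁n⟩ := hNres n hn
        have hle := fromN e₁ he₁ n
        simp only [Finsupp.coe_add, Pi.add_apply, tau_apply_ne Nor L e₁ (Ne.symm hnL), he₁n, hB, Finsupp.single_apply,
          if_neg hnL] at hle ⊢
        omega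
      · have hn' : n ∉ S'.Exc := by
          rw [hExc', Finset.mem_insert]; rintro (h | h); exact hnL h.symm; exact hn h
        have hBn : B n = 0 := by
          simp only [hB, Finsupp.coe_add, Pi.add_apply, Finsupp.single_apply, if_neg hnL, zero_add]; exact hα'off n hn'
        omega
  · -- A n + [L = n] ν ≤ B n
    by_cases hn : n ∈ S'.Exc
    · obtain ⟨e₀, he₀, he₀n⟩ := hN'res n hn
      obtain ⟨hAle, e₁, he₁, heq⟩ := fromN' e₀ he₀
      have hcoord : B n + e₀ n = A n + tau Nor L e₁ n := by
        have h1 := congrArg (fun f => f n) heq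
        simp only [Finsupp.coe_tsub, Pi.sub_apply, Finsupp.coe_add, Pi.add_apply] at h1
        have h2 : A n ≤ (B + e₀) n := hAle n
        simp only [Finsupp.coe_add, Pi.add_apply] at h2
        omega
      by_cases hnL : L = n
      · subst hnL
        rw [if_pos rfl]
        have h1 : tau Nor L e₁ L = norDeg Nor e₁ := tau_apply_self Nor L e₁ hL
        have h2 : ν ≤ norDeg Nor e₁ := hν₂ e₁ he₁
        simp only [hB, Finsupp.coe_add, Pi.add_apply, Finsupp.single_eq_same] at hcoord ⊢
        omega
      · rw [if_neg hnL, add_zero]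
        have h1 : tau Nor L e₁ n = e₁ n := tau_apply_ne Nor L e₁ (Ne.symm hnL)
        simp only [hB, Finsupp.coe_add, Pi.add_apply, Finsupp.single_apply, if_neg hnL] at hcoord ⊢
        omega
    · have hnL : L ≠ n := by rintro rfl; exact hn (by rw [hExc']; exact Finset.mem_insert_self _ _)
      have hnE : n ∉ S.Exc := fun h => hn (by rw [hExc']; exact Finset.mem_insert_of_mem h)
      rw [if_neg hnL, add_zero, hA, tau_apply_ne Nor L α (Ne.symm hnL), hαoff n hnE]
      exact Nat.zero_le _

/-- POINT-STEP form of the exponent identity: `α′_n = α_n` for `n ≠ L`, and `α′_L + 6 = |α| + ν`. [OURS · L1 W4.5a] -/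
theorem alpha_point_step {S S' : Stage k} {L : Letter} {α α' : Expo} {N N' : YPoly k}
    (hch : IsChart S Finset.univ L S') (hN : IsResidual S.Exc S.D α N) (hN' : IsResidual S'.Exc S'.D α' N')
    {ν : ℕ} (hν₁ : ∃ e ∈ N.support, tdeg e = ν) (hν₂ : ∀ e ∈ N.support, ν ≤ tdeg e) :
    (∀ n, n ≠ L → α' n = α n) ∧ α' L + 6 = tdeg α + ν := by
  have hid := alpha_transport (Finset.mem_univ L) hch hN hN' (ν := ν)
    (by obtain ⟨e, he, h⟩ := hν₁; exact ⟨e, he, h⟩) (fun e he => hν₂ e he)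
  constructor
  · intro n hn
    have := congrArg (fun f => f n) hid
    simp only [Finsupp.coe_add, Pi.add_apply, Finsupp.single_apply, if_neg (Ne.symm hn), zero_add, add_zero,
      tau_apply_ne Finset.univ L α hn] at this
    exact this
  · have := congrArg (fun f => f L) hid
    simp only [Finsupp.coe_add, Pi.add_apply, Finsupp.single_eq_same, tau_apply_self Finset.univ L α (Finset.mem_univ L)] at this
    have hn : norDeg Finset.univ α = tdeg α := rfl
    omega

/-- THE INVARIANT of the point-chain cap: either the residual order is already `≤ 8`, or every exceptional letter has NON-POSITIVE SLACK (`2d_n ≤ α_n`).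
[OURS · L1 W4.5a] -/
def PointTame (S : Stage k) (α : Expo) (N : YPoly k) : Prop :=
  OrdLE N 8 ∨ ∀ n ∈ S.Exc, 2 * S.d n ≤ (α n : ℤ)

/-- ★ The invariant is PRESERVED by a point blow-up (any chart origin). [OURS · L1 W4.5a] -/
theorem pointTame_step {S S' : Stage k} {L : Letter} {α α' : Expo} {N N' : YPoly k}
    (hch : IsChart S Finset.univ L S') (hN : IsResidual S.Exc S.D α N) (hN' : IsResidual S'.Exc S'.D α' N')
    (hT : PointTame S α N) : PointTame S' α' N' := by
  classical
  -- N ≠ 0: from the residual witness at x′ (L ∈ Exc′) through the support equation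
  have hL' : L ∈ S'.Exc := by rw [hch.2.2.2.1]; exact Finset.mem_insert_self _ _
  have hN0 : N.support.Nonempty := by
    by_contra hemp
    rw [Finset.not_nonempty_iff_eq_empty, MvPolynomial.support_eq_empty] at hemp
    obtain ⟨e₀, he₀, -⟩ := hN'.2.2 L hL'
    have hEQ : chartMap Finset.univ L S.D = X L ^ 6 * S'.D := disc_chart hch
    rw [hN.1, hemp, mul_zero, map_zero, hN'.1, ← mul_assoc, X_pow_eq_monomial, monomial_mul, one_mul] at hEQ
    have := congrArg (coeff (Finsupp.single L 6 + α' + e₀)) hEQ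
    rw [coeff_zero, coeff_add_monomial_mul] at this
    exact (MvPolynomial.mem_support_iff.mp he₀) this.symm
  obtain ⟨e₀, he₀, hmin⟩ := Finset.exists_min_image N.support tdeg hN0
  set ν := tdeg e₀ with hνdef
  -- if ρ ≤ 8 at x then ρ′ ≤ 8 at x′ by the point law
  by_cases h8 : ν ≤ 8
  · left; exact rho_le_rho_of_point hch hN hN' ⟨e₀, he₀, h8⟩
  rcases hT with hle | hslack
  · left; exact rho_le_rho_of_point hch hN hN' hle
  · right
    obtain ⟨hα'n, hα'L⟩ := alpha_point_step hch hN hN' ⟨e₀, he₀, rfl⟩ hmin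
    have hExc' : S'.Exc = insert L S.Exc := hch.2.2.2.1
    have hdn : ∀ n, n ≠ L → S'.d n = S.d n := hch.2.2.2.2.1
    have hdL : S'.d L = ((Finset.univ : Finset Letter).card : ℤ) + 1 - 4 + ∑ n ∈ S.Exc ∩ Finset.univ, S.d n := hch.2.2.2.2.2
    rw [Finset.inter_univ] at hdL
    have hcard : ((Finset.univ : Finset Letter).card : ℤ) = 4 := by simp
    -- Σ_{Exc} 2 d ≤ Σ_{Exc} α ≤ |α|
    have hsumd : 2 * ∑ n ∈ S.Exc, S.d n ≤ (tdeg α : ℤ) := by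
      rw [Finset.mul_sum]
      calc ∑ n ∈ S.Exc, 2 * S.d n ≤ ∑ n ∈ S.Exc, (α n : ℤ) := Finset.sum_le_sum fun n hn => hslack n hn
        _ ≤ ∑ n, (α n : ℤ) := Finset.sum_le_sum_of_subset_of_nonneg (Finset.subset_univ _) fun n _ _ => by positivity
        _ = (tdeg α : ℤ) := by rw [tdeg]; push_cast; rfl
    intro n hn
    by_cases hnL : n = L
    · subst hnL
      rw [hdL, hcard]
      have : (α' n : ℤ) + 6 = (tdeg α : ℤ) + ν := by exact_mod_cast hα'L
      have hν9 : (9 : ℤ) ≤ ν := by exact_mod_cast (show 9 ≤ ν by omega)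
      linarith
    · rw [hdn n hnL, hα'n n hnL]
      have hn' : n ∈ S.Exc := by
        rw [hExc', Finset.mem_insert] at hn
        rcases hn with h | h; exact absurd h hnL; exact h
      exact hslack n hn'

/-- ★ AT A DROP POINT the invariant plus the drop-point budget give `ρ′ ≤ 8`. [OURS · L1 W4.5a] -/
theorem ordLE_eight_of_pointTame_drop {S S' : Stage k} {L : Letter} {α α' : Expo} {N N' : YPoly k}
    (hch : IsChart S Finset.univ L S') (hN : IsResidual S.Exc S.D α N) (hN' : IsResidual S'.Exc S'.D α' N')
    (hT : PointTame S α N) (hbud : ∃ f ∈ S'.D.support, (tdeg f : ℤ) ≤ 8 + 2 * ∑ n ∈ S'.Exc, S'.d n) : OrdLE N' 8 := by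
  classical
  have hL' : L ∈ S'.Exc := by rw [hch.2.2.2.1]; exact Finset.mem_insert_self _ _
  have hN0 : N.support.Nonempty := by
    by_contra hemp
    rw [Finset.not_nonempty_iff_eq_empty, MvPolynomial.support_eq_empty] at hemp
    obtain ⟨e₀, he₀, -⟩ := hN'.2.2 L hL'
    have hEQ : chartMap Finset.univ L S.D = X L ^ 6 * S'.D := disc_chart hch
    rw [hN.1, hemp, mul_zero, map_zero, hN'.1, ← mul_assoc, X_pow_eq_monomial, monomial_mul, one_mul] at hEQ
    have := congrArg (coeff (Finsupp.single L 6 + α' + e₀)) hEQ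
    rw [coeff_zero, coeff_add_monomial_mul] at this
    exact (MvPolynomial.mem_support_iff.mp he₀) this.symm
  obtain ⟨e₀, he₀, hmin⟩ := Finset.exists_min_image N.support tdeg hN0
  set ν := tdeg e₀ with hνdef
  by_cases h8 : ν ≤ 8
  · exact rho_le_rho_of_point hch hN hN' ⟨e₀, he₀, h8⟩
  rcases hT with hle | hslack
  · exact rho_le_rho_of_point hch hN hN' hle
  -- slacks ≤ 0 and ν ≥ 9: the budget monomial
  obtain ⟨hα'n, hα'L⟩ := alpha_point_step hch hN hN' ⟨e₀, he₀, rfl⟩ hmin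
  have hExc' : S'.Exc = insert L S.Exc := hch.2.2.2.1
  have hdn : ∀ n, n ≠ L → S'.d n = S.d n := hch.2.2.2.2.1
  have hdL : S'.d L = ((Finset.univ : Finset Letter).card : ℤ) + 1 - 4 + ∑ n ∈ S.Exc ∩ Finset.univ, S.d n := hch.2.2.2.2.2
  rw [Finset.inter_univ] at hdL
  have hcard : ((Finset.univ : Finset Letter).card : ℤ) = 4 := by simp
  obtain ⟨f, hf, hfb⟩ := hbud
  have hc : coeff f (monomial α' (1 : k) * N') ≠ 0 := by rw [← hN'.1]; exact MvPolynomial.mem_support_iff.mp hf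
  obtain ⟨hle, hc2⟩ := le_and_coeff_of_coeff_monomial_mul hc
  refine ⟨f - α', MvPolynomial.mem_support_iff.mpr hc2, ?_⟩
  rw [tdeg_tsub hle]
  -- Σ_{Exc′} d′ = d′_L + Σ_{Exc ∖ L} d  and  |α′| = α′_L + Σ_{n ≠ L} α_n
  have hsum_d : (∑ n ∈ S'.Exc, S'.d n) = S'.d L + ∑ n ∈ S.Exc.erase L, S.d n := by
    have hins : S'.Exc = insert L (S.Exc.erase L) := by
      rw [hExc']; ext n; simp only [Finset.mem_insert, Finset.mem_erase]; tauto
    rw [hins, Finset.sum_insert (Finset.notMem_erase L S.Exc)]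
    congr 1
    exact Finset.sum_congr rfl fun n hn => hdn n (Finset.ne_of_mem_erase hn)
  have hsum_α' : (tdeg α' : ℤ) = (α' L : ℤ) + ∑ n ∈ Finset.univ.erase L, (α n : ℤ) := by
    rw [tdeg, Nat.cast_sum, ← Finset.add_sum_erase Finset.univ _ (Finset.mem_univ L)]
    congr 1
    exact Finset.sum_congr rfl fun n hn => by rw [hα'n n (Finset.ne_of_mem_erase hn)]
  have hsum_α : (tdeg α : ℤ) = (α L : ℤ) + ∑ n ∈ Finset.univ.erase L, (α n : ℤ) := by
    rw [tdeg, Nat.cast_sum, ← Finset.add_sum_erase Finset.univ _ (Finset.mem_univ L)]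
  -- slack sums
  have hs1 : 2 * ∑ n ∈ S.Exc, S.d n ≤ ∑ n ∈ S.Exc, (α n : ℤ) := by
    rw [Finset.mul_sum]; exact Finset.sum_le_sum fun n hn => hslack n hn
  have hs2 : 2 * ∑ n ∈ S.Exc.erase L, S.d n ≤ ∑ n ∈ S.Exc.erase L, (α n : ℤ) := by
    rw [Finset.mul_sum]; exact Finset.sum_le_sum fun n hn => hslack n (Finset.mem_of_mem_erase hn)
  have hsub1 : (∑ n ∈ S.Exc, (α n : ℤ)) ≤ (tdeg α : ℤ) := by
    rw [tdeg, Nat.cast_sum]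
    exact Finset.sum_le_sum_of_subset_of_nonneg (Finset.subset_univ _) fun n _ _ => by positivity
  have hsub2 : (∑ n ∈ S.Exc.erase L, (α n : ℤ)) ≤ ∑ n ∈ Finset.univ.erase L, (α n : ℤ) :=
    Finset.sum_le_sum_of_subset_of_nonneg (Finset.erase_subset_erase L (Finset.subset_univ _)) fun n _ _ => by positivity
  have hα'L' : (α' L : ℤ) + 6 = (tdeg α : ℤ) + ν := by exact_mod_cast hα'L
  have hν9 : (9 : ℤ) ≤ ν := by exact_mod_cast (show 9 ≤ ν by omega)
  have htf : (tdeg f : ℤ) - (tdeg α' : ℤ) ≤ 7 := by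
    rw [hsum_d, hdL, hcard] at hfb
    nlinarith [hfb, hsum_α', hsum_α, hs1, hs2, hsub1, hsub2, hα'L', hν9]
  have : tdeg α' ≤ tdeg f := tdeg_mono hle
  omega

/-- Chains of POINT blow-ups (any chart origins). [OURS · L1 W4.5a] -/
inductive PointReachable (S₀ : Stage k) : Stage k → Prop
  | refl : PointReachable S₀ S₀
  | step {S S' : Stage k} (L : Letter) : PointReachable S₀ S → IsChart S Finset.univ L S' → PointReachable S₀ S'

/-- Along a point chain from an exceptional-free stage, every stage with nonzero discriminant carries a residual decomposition satisfying the invariant.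
[OURS · L1 W4.5a · plumbing] -/
theorem pointTame_of_reachable {S₀ S : Stage k} (hExc : S₀.Exc = ∅) (h : PointReachable S₀ S) (hD : S.D ≠ 0) :
    ∃ (α : Expo) (N : YPoly k), IsResidual S.Exc S.D α N ∧ PointTame S α N := by
  induction h with
  | refl =>
    obtain ⟨α, N, hres⟩ := exists_isResidual S₀.Exc S₀.D hD
    exact ⟨α, N, hres, Or.inr fun n hn => by rw [hExc] at hn; exact absurd hn (Finset.notMem_empty n)⟩
  | @step S S' L hprev hch ih =>
    have hD0 : S.D ≠ 0 := by
      intro hz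
      have hEQ : chartMap Finset.univ L S.D = X L ^ 6 * S'.D := disc_chart hch
      rw [hz, map_zero] at hEQ
      exact hD (by
        have := hEQ.symm
        rcases mul_eq_zero.mp this with h | h
        · exact absurd h (pow_ne_zero _ (X_ne_zero L))
        · exact h)
    obtain ⟨α, N, hres, hT⟩ := ih hD0
    obtain ⟨α', N', hres'⟩ := exists_isResidual S'.Exc S'.D hD
    exact ⟨α', N', hres', pointTame_step hch hres hres' hT⟩

/-- ★★★ THE POINT-CHAIN CAP (typed): from a stage WITHOUT exceptional letters, along ANY chain of point blow-ups (any chart origins), at a stage reached by a last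
point blow-up and carrying the DROP-POINT BUDGET `ord₀ Disc ≤ 8 + 2·Σ_{E∋x} d_E`, EVERY residual decomposition has `ord₀ N ≤ 8`. No canonicity, no toric budget,
no drop-point shape needed — only the drop-point budget at the end (R26.21 (β)). [OURS · L1 W4.5a] -/
theorem pointChain_cap {S₀ S T : Stage k} {L : Letter} {αT : Expo} {NT : YPoly k} (hExc : S₀.Exc = ∅)
    (hreach : PointReachable S₀ S) (hch : IsChart S Finset.univ L T) (hres : IsResidual T.Exc T.D αT NT)
    (hbud : ∃ f ∈ T.D.support, (tdeg f : ℤ) ≤ 8 + 2 * ∑ n ∈ T.Exc, T.d n) : OrdLE NT 8 := by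
  classical
  -- T.D ≠ 0 from the residual witness, hence S.D ≠ 0
  have hL' : L ∈ T.Exc := by rw [hch.2.2.2.1]; exact Finset.mem_insert_self _ _
  obtain ⟨e₀, he₀, -⟩ := hres.2.2 L hL'
  have hTD : T.D ≠ 0 := by
    intro hz
    have := MvPolynomial.mem_support_iff.mp he₀
    apply this
    have h1 : T.D = monomial αT 1 * NT := hres.1
    rw [hz] at h1
    have := congrArg (coeff (αT + e₀)) h1
    rw [coeff_zero, coeff_add_monomial_mul] at this
    exact this.symm
  have hSD : S.D ≠ 0 := by
    intro hz
    have hEQ : chartMap Finset.univ L S.D = X L ^ 6 * T.D := disc_chart hch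
    rw [hz, map_zero] at hEQ
    rcases mul_eq_zero.mp hEQ.symm with h | h
    · exact absurd h (pow_ne_zero _ (X_ne_zero L))
    · exact hTD h
  obtain ⟨α, N, hresS, hT⟩ := pointTame_of_reachable hExc hreach hSD
  exact ordLE_eight_of_pointTame_drop hch hresS hres hT hbud

end Summit.ResolutionOfSingularities.ResolutionOfSingularities.Theorems.FInjectiveMacaulayfication.LastCentrePointChain

end
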